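import Mathlib

/-!
# `MatrixDescartes` (stmt-ValiantsHypothesis-18050), line `Lift` — the V-law from the two CHAIN LEMMAS
# (kernel-checked reduction; the chain lemmas = Lemma FULL of the paper proof `VLAW-PROOF.md`)

HONEST FRAMING.  Cell `pub-symmetroid`, seat `val-sym-mdr-p2`; helper `--supports` the crux
`Theses.LacunarySymmetroid.MatrixDescartes`.  This file is a CONDITIONAL theorem: it derives the registered
research stub `stub_vLaw` (`Cruxes/MatrixDescartes/Lines/Lift.lean`: `Z₊ ≤ 2·card ι` for
`det (X^e J + X^{d₁} P + X^{d₂} Q)`) from two explicitly stated hypotheses `hA`, `hD` — the ASCENDING and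
DESCENDING CHAIN LEMMAS — which are proved ON PAPER (for `P, Q ⪰ 0`, `J` symmetric, `d₁ < e < d₂`) in the evidence
file `VLAW-PROOF.md` attached to the crux item (Lemma FULL: Hadamard factorisation + Stieltjes representation of
`t^{-a/b}`), but NOT yet in Lean.  Nothing here bears on `stub_twoSided`, the crux, `DoorA26`/`DoorA34`, or
`VP ≠ VNP`.

THE REDUCTION (`vLaw_of_chainLemmas`).  Write `G(t) = t^e J + t^{d₁} P + t^{d₂} Q` (real matrix, `t > 0`).  At a
positive zero `t` of `det G` pick a kernel vector `v ≠ 0`; comparing `(e−d₁)·t^{d₁}·vᵀPv` with `(d₂−e)·t^{d₂}·vᵀQv`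
(the sign of the derivative of the quadratic form `vᵀG(·)v` at its zero `t`, up to the factor `t`) every zero is
ASCENDING (`≤`) or DESCENDING (`≥`).  Hypothesis `hA` says: for kernel vectors `v₀,…,v_{k−1}` at increasing
ascending zeros `τ₀ < … < τ_{k−1}` which are linearly independent, the quadratic form of `G(s)` is positive on
their span for every later time `s`; `hD` is the mirror statement (decreasing zeros, earlier times).  The abstract
chain lemma `VLawChain.linearIndependent_of_chain` (prefix induction with `linearIndependent_finSnoc`: a new kernel
vector in the span of the earlier ones would be a nonzero vector on which the form of `G(τ_j)` both vanishes and is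
positive) then makes ALL ascending kernel vectors independent, so there are at most `card ι` ascending zeros, and
likewise descending ones: `Z₊ ≤ 2·card ι`.  Elementary linear algebra; axioms `propext`, `Classical.choice`,
`Quot.sound`.
-/

-- layout Summits/ValiantsHypothesis/ValiantsHypothesis forces the duplicated namespace component
set_option linter.dupNamespace false

namespace Summit.ValiantsHypothesis.ValiantsHypothesis.Theorems.LacunarySymmetroidMatrixDescartes

open Polynomial Matrix Finset
open scoped BigOperators

namespace VLawChain

variable {ι : Type*} [Fintype ι] [DecidableEq ι]

/-- Evaluating the determinant of the V-pencil at a real point. [folklore] -/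
theorem eval_det_vPencil (e d₁ d₂ : ℕ) (J P Q : Matrix ι ι ℝ) (t : ℝ) :
    (Matrix.det (((Polynomial.X : Polynomial ℝ) ^ e) • J.map Polynomial.C
        + ((Polynomial.X : Polynomial ℝ) ^ d₁) • P.map Polynomial.C
        + ((Polynomial.X : Polynomial ℝ) ^ d₂) • Q.map Polynomial.C)).eval t
      = Matrix.det (t ^ e • J + t ^ d₁ • P + t ^ d₂ • Q) := by
  have h := RingHom.map_det (Polynomial.evalRingHom t)
    (((Polynomial.X : Polynomial ℝ) ^ e) • J.map Polynomial.C
        + ((Polynomial.X : Polynomial ℝ) ^ d₁) • P.map Polynomial.C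
        + ((Polynomial.X : Polynomial ℝ) ^ d₂) • Q.map Polynomial.C)
  rw [Polynomial.coe_evalRingHom] at h
  rw [h]
  congr 1
  ext i j
  simp only [RingHom.mapMatrix_apply, Matrix.map_apply, Matrix.add_apply, Matrix.smul_apply,
    smul_eq_mul, Polynomial.coe_evalRingHom, Polynomial.eval_add, Polynomial.eval_mul,
    Polynomial.eval_pow, Polynomial.eval_X, Polynomial.eval_C]

omit [DecidableEq ι] in
/-- **Abstract chain lemma.**  Times `τ j`, nonzero vectors `v j` with `G (τ j) *ᵥ v j = 0`; if, for every
`j`, linear independence of the prefix `v 0, …, v (j−1)` forces the quadratic form of `G (τ j)` to be positive at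
every nonzero combination of that prefix, then the whole family `v` is linearly independent (prefix induction:
a new vector inside the span of an independent prefix would be a nonzero combination on which the form of
`G (τ j)` vanishes). [folklore] -/
theorem linearIndependent_of_chain (G : ℝ → Matrix ι ι ℝ) {k : ℕ} (τ : Fin k → ℝ) (v : Fin k → ι → ℝ)
    (hv0 : ∀ j, v j ≠ 0) (hker : ∀ j, G (τ j) *ᵥ v j = 0)
    (hpos : ∀ (j : ℕ) (hj : j < k),
      LinearIndependent ℝ (fun i : Fin j => v (Fin.castLE hj.le i)) →
      ∀ c : Fin j → ℝ, c ≠ 0 →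
        0 < (∑ i, c i • v (Fin.castLE hj.le i)) ⬝ᵥ
          (G (τ ⟨j, hj⟩) *ᵥ ∑ i, c i • v (Fin.castLE hj.le i))) :
    LinearIndependent ℝ v := by
  have key : ∀ (j : ℕ) (hj : j ≤ k), LinearIndependent ℝ (fun i : Fin j => v (Fin.castLE hj i)) := by
    intro j
    induction j with
    | zero => intro _; exact linearIndependent_empty_type
    | succ j ih =>
      intro hj
      have hjk : j < k := hj
      have ih' := ih hjk.le
      have hsnoc : (fun i : Fin (j + 1) => v (Fin.castLE hj i))
          = (Fin.snoc (fun i : Fin j => v (Fin.castLE hjk.le i)) (v ⟨j, hjk⟩) : Fin (j + 1) → ι → ℝ) := by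
        funext i
        refine Fin.lastCases ?_ (fun i' => ?_) i
        · rw [Fin.snoc_last]
          rfl
        · rw [Fin.snoc_castSucc]
          rfl
      rw [hsnoc, linearIndependent_finSnoc]
      refine ⟨ih', fun hmem => ?_⟩
      obtain ⟨c, hc⟩ := (Submodule.mem_span_range_iff_exists_fun ℝ).1 hmem
      by_cases hc0 : c = 0
      · rw [hc0] at hc
        simp only [Pi.zero_apply, zero_smul, Finset.sum_const_zero] at hc
        exact hv0 ⟨j, hjk⟩ hc.symm
      · have h := hpos j hjk ih' c hc0
        rw [hc, hker ⟨j, hjk⟩, dotProduct_zero] at h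
        exact lt_irrefl 0 h
  exact key k le_rfl

end VLawChain

/-- **The V-law from the chain lemmas** (conditional reduction of the registered stub `stub_vLaw`).  For real
`ι × ι` matrices `J, P, Q` and exponents `e, d₁, d₂`, write `G(t) = t^e J + t^{d₁} P + t^{d₂} Q`.  ASSUME the
ascending chain lemma `hA` (for linearly independent kernel vectors `v j` of `G(τ j)` at increasing positive times
with `(e−d₁) τ_j^{d₁} v_jᵀPv_j ≤ (d₂−e) τ_j^{d₂} v_jᵀQv_j`, the form of `G(s)` is positive on nonzero combinations
of the `v j` at every later time `s`) and its mirror `hD` (decreasing times, reversed inequality, earlier positive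
times).  THEN `det (X^e J + X^{d₁} P + X^{d₂} Q)` has at most `2·card ι` distinct positive zeros.  Both
hypotheses hold when `P, Q ⪰ 0`, `J` is symmetric and `d₁ < e < d₂` — Lemma FULL of the evidence file
`VLAW-PROOF.md` on stmt-ValiantsHypothesis-18050 (paper proof; Hadamard factorisation through the Stieltjes
function `t^{-(e−d₁)/(d₂−e)}` or its reciprocal exponent), not yet kernel-checked. [folklore] -/
theorem vLaw_of_chainLemmas (ι : Type) [Fintype ι] [DecidableEq ι] (e d₁ d₂ : ℕ) (J P Q : Matrix ι ι ℝ)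
    (hA : ∀ (k : ℕ) (τ : Fin k → ℝ) (v : Fin k → ι → ℝ), StrictMono τ → (∀ j, 0 < τ j) →
      LinearIndependent ℝ v →
      (∀ j, (τ j ^ e • J + τ j ^ d₁ • P + τ j ^ d₂ • Q) *ᵥ v j = 0) →
      (∀ j, ((e : ℝ) - d₁) * τ j ^ d₁ * (v j ⬝ᵥ (P *ᵥ v j))
          ≤ ((d₂ : ℝ) - e) * τ j ^ d₂ * (v j ⬝ᵥ (Q *ᵥ v j))) →
      ∀ s : ℝ, (∀ j, τ j < s) → ∀ c : Fin k → ℝ, c ≠ 0 →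
        0 < (∑ j, c j • v j) ⬝ᵥ ((s ^ e • J + s ^ d₁ • P + s ^ d₂ • Q) *ᵥ ∑ j, c j • v j))
    (hD : ∀ (k : ℕ) (τ : Fin k → ℝ) (v : Fin k → ι → ℝ), StrictAnti τ → (∀ j, 0 < τ j) →
      LinearIndependent ℝ v →
      (∀ j, (τ j ^ e • J + τ j ^ d₁ • P + τ j ^ d₂ • Q) *ᵥ v j = 0) →
      (∀ j, ((d₂ : ℝ) - e) * τ j ^ d₂ * (v j ⬝ᵥ (Q *ᵥ v j))
          ≤ ((e : ℝ) - d₁) * τ j ^ d₁ * (v j ⬝ᵥ (P *ᵥ v j))) →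
      ∀ s : ℝ, 0 < s → (∀ j, s < τ j) → ∀ c : Fin k → ℝ, c ≠ 0 →
        0 < (∑ j, c j • v j) ⬝ᵥ ((s ^ e • J + s ^ d₁ • P + s ^ d₂ • Q) *ᵥ ∑ j, c j • v j)) :
    ((Matrix.det (((Polynomial.X : Polynomial ℝ) ^ e) • J.map Polynomial.C
        + ((Polynomial.X : Polynomial ℝ) ^ d₁) • P.map Polynomial.C
        + ((Polynomial.X : Polynomial ℝ) ^ d₂) • Q.map Polynomial.C)).roots.toFinset.filter
          (fun t => 0 < t)).card ≤ 2 * Fintype.card ι := by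
  classical
  set p := Matrix.det (((Polynomial.X : Polynomial ℝ) ^ e) • J.map Polynomial.C
        + ((Polynomial.X : Polynomial ℝ) ^ d₁) • P.map Polynomial.C
        + ((Polynomial.X : Polynomial ℝ) ^ d₂) • Q.map Polynomial.C) with hp
  by_cases hdet : p = 0
  · simp [hdet]
  set G : ℝ → Matrix ι ι ℝ := fun t => t ^ e • J + t ^ d₁ • P + t ^ d₂ • Q with hG
  set R := p.roots.toFinset.filter (fun t => 0 < t) with hR
  have hroot : ∀ t ∈ R, 0 < t ∧ Matrix.det (G t) = 0 := by
    intro t ht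
    have h1 := (Finset.mem_filter.1 ht)
    rw [Multiset.mem_toFinset, Polynomial.mem_roots hdet, Polynomial.IsRoot.def, hp,
      VLawChain.eval_det_vPencil] at h1
    exact ⟨h1.2, h1.1⟩
  -- ascending / descending predicates
  set TA : ℝ → Prop := fun t => ∃ v : ι → ℝ, v ≠ 0 ∧ G t *ᵥ v = 0 ∧
      ((e : ℝ) - d₁) * t ^ d₁ * (v ⬝ᵥ (P *ᵥ v)) ≤ ((d₂ : ℝ) - e) * t ^ d₂ * (v ⬝ᵥ (Q *ᵥ v)) with hTA
  set TD : ℝ → Prop := fun t => ∃ v : ι → ℝ, v ≠ 0 ∧ G t *ᵥ v = 0 ∧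
      ((d₂ : ℝ) - e) * t ^ d₂ * (v ⬝ᵥ (Q *ᵥ v)) ≤ ((e : ℝ) - d₁) * t ^ d₁ * (v ⬝ᵥ (P *ᵥ v)) with hTD
  have hcover : R ⊆ R.filter TA ∪ R.filter TD := by
    intro t ht
    obtain ⟨v, hv, hGv⟩ := Matrix.exists_mulVec_eq_zero_iff.2 (hroot t ht).2
    rcases le_total (((e : ℝ) - d₁) * t ^ d₁ * (v ⬝ᵥ (P *ᵥ v)))
        (((d₂ : ℝ) - e) * t ^ d₂ * (v ⬝ᵥ (Q *ᵥ v))) with h | h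
    · exact Finset.mem_union.2 (Or.inl (Finset.mem_filter.2 ⟨ht, v, hv, hGv, h⟩))
    · exact Finset.mem_union.2 (Or.inr (Finset.mem_filter.2 ⟨ht, v, hv, hGv, h⟩))
  -- ascending zeros: at most `card ι`
  have hcardA : (R.filter TA).card ≤ Fintype.card ι := by
    set RA := R.filter TA with hRA
    let τ : Fin RA.card ↪o ℝ := RA.orderEmbOfFin rfl
    have hτmem : ∀ j, τ j ∈ RA := fun j => RA.orderEmbOfFin_mem rfl j
    have hτA : ∀ j, TA (τ j) := fun j => (Finset.mem_filter.1 (hτmem j)).2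
    have hτpos : ∀ j, 0 < τ j := fun j => (hroot _ (Finset.mem_filter.1 (hτmem j)).1).1
    choose v hv0 hker htyp using hτA
    have hli : LinearIndependent ℝ v :=
      VLawChain.linearIndependent_of_chain G τ v hv0 hker fun j hj hind c hc =>
        hA j (fun i => τ (Fin.castLE hj.le i)) (fun i => v (Fin.castLE hj.le i))
          (fun i i' h => τ.strictMono (show Fin.castLE hj.le i < Fin.castLE hj.le i' from h))
          (fun i => hτpos _) hind (fun i => hker _) (fun i => htyp _) (τ ⟨j, hj⟩)
          (fun i => τ.strictMono (show Fin.castLE hj.le i < ⟨j, hj⟩ from i.2)) c hc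
    have h := hli.fintype_card_le_finrank
    rwa [Fintype.card_fin, Module.finrank_fintype_fun_eq_card] at h
  -- descending zeros: at most `card ι` (enumerate decreasingly)
  have hcardD : (R.filter TD).card ≤ Fintype.card ι := by
    set RD := R.filter TD with hRD
    let τ₀ : Fin RD.card ↪o ℝ := RD.orderEmbOfFin rfl
    set τ : Fin RD.card → ℝ := fun j => τ₀ (Fin.rev j) with hτ
    have hτanti : StrictAnti τ := fun i i' h => τ₀.strictMono (Fin.rev_lt_rev.2 h)
    have hτmem : ∀ j, τ j ∈ RD := fun j => RD.orderEmbOfFin_mem rfl (Fin.rev j)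
    have hτD : ∀ j, TD (τ j) := fun j => (Finset.mem_filter.1 (hτmem j)).2
    have hτpos : ∀ j, 0 < τ j := fun j => (hroot _ (Finset.mem_filter.1 (hτmem j)).1).1
    choose v hv0 hker htyp using hτD
    have hli : LinearIndependent ℝ v :=
      VLawChain.linearIndependent_of_chain G τ v hv0 hker fun j hj hind c hc =>
        hD j (fun i => τ (Fin.castLE hj.le i)) (fun i => v (Fin.castLE hj.le i))
          (fun i i' h => hτanti (show Fin.castLE hj.le i < Fin.castLE hj.le i' from h))
          (fun i => hτpos _) hind (fun i => hker _) (fun i => htyp _) (τ ⟨j, hj⟩) (hτpos _)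
          (fun i => hτanti (show Fin.castLE hj.le i < ⟨j, hj⟩ from i.2)) c hc
    have h := hli.fintype_card_le_finrank
    rwa [Fintype.card_fin, Module.finrank_fintype_fun_eq_card] at h
  calc R.card ≤ (R.filter TA ∪ R.filter TD).card := Finset.card_le_card hcover
    _ ≤ (R.filter TA).card + (R.filter TD).card := Finset.card_union_le _ _
    _ ≤ Fintype.card ι + Fintype.card ι := Nat.add_le_add hcardA hcardD
    _ = 2 * Fintype.card ι := by ring

end Summit.ValiantsHypothesis.ValiantsHypothesis.Theorems.LacunarySymmetroidMatrixDescartes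

namespace Summit.ValiantsHypothesis.ValiantsHypothesis.Theorems.LacunarySymmetroidMatrixDescartes

open Polynomial Matrix Finset
open scoped BigOperators

/-- **The V-law from the chain lemmas, nondegenerate form.**  Same reduction as `vLaw_of_chainLemmas`, but the
two chain hypotheses are only required when the determinant polynomial is NONZERO — the form in which they are
actually true for `P, Q ⪰ 0`, `J` symmetric, `d₁ < e < d₂` (Lemma FULL of `VLAW-PROOF.md` needs the
nondegeneracy "no common kernel vector of `P, J, Q`", which follows from `det ≢ 0`; without it a common kernel
vector `v` gives the counterexample `k = 1`, `vᵀG(s)v = 0`).  When the determinant is the zero polynomial there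
are no counted roots. [folklore] -/
theorem vLaw_of_chainLemmas_nd (ι : Type) [Fintype ι] [DecidableEq ι] (e d₁ d₂ : ℕ) (J P Q : Matrix ι ι ℝ)
    (hA : Matrix.det (((Polynomial.X : Polynomial ℝ) ^ e) • J.map Polynomial.C
        + ((Polynomial.X : Polynomial ℝ) ^ d₁) • P.map Polynomial.C
        + ((Polynomial.X : Polynomial ℝ) ^ d₂) • Q.map Polynomial.C) ≠ 0 →
      ∀ (k : ℕ) (τ : Fin k → ℝ) (v : Fin k → ι → ℝ), StrictMono τ → (∀ j, 0 < τ j) →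
      LinearIndependent ℝ v →
      (∀ j, (τ j ^ e • J + τ j ^ d₁ • P + τ j ^ d₂ • Q) *ᵥ v j = 0) →
      (∀ j, ((e : ℝ) - d₁) * τ j ^ d₁ * (v j ⬝ᵥ (P *ᵥ v j))
          ≤ ((d₂ : ℝ) - e) * τ j ^ d₂ * (v j ⬝ᵥ (Q *ᵥ v j))) →
      ∀ s : ℝ, (∀ j, τ j < s) → ∀ c : Fin k → ℝ, c ≠ 0 →
        0 < (∑ j, c j • v j) ⬝ᵥ ((s ^ e • J + s ^ d₁ • P + s ^ d₂ • Q) *ᵥ ∑ j, c j • v j))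
    (hD : Matrix.det (((Polynomial.X : Polynomial ℝ) ^ e) • J.map Polynomial.C
        + ((Polynomial.X : Polynomial ℝ) ^ d₁) • P.map Polynomial.C
        + ((Polynomial.X : Polynomial ℝ) ^ d₂) • Q.map Polynomial.C) ≠ 0 →
      ∀ (k : ℕ) (τ : Fin k → ℝ) (v : Fin k → ι → ℝ), StrictAnti τ → (∀ j, 0 < τ j) →
      LinearIndependent ℝ v →
      (∀ j, (τ j ^ e • J + τ j ^ d₁ • P + τ j ^ d₂ • Q) *ᵥ v j = 0) →
      (∀ j, ((d₂ : ℝ) - e) * τ j ^ d₂ * (v j ⬝ᵥ (Q *ᵥ v j))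
          ≤ ((e : ℝ) - d₁) * τ j ^ d₁ * (v j ⬝ᵥ (P *ᵥ v j))) →
      ∀ s : ℝ, 0 < s → (∀ j, s < τ j) → ∀ c : Fin k → ℝ, c ≠ 0 →
        0 < (∑ j, c j • v j) ⬝ᵥ ((s ^ e • J + s ^ d₁ • P + s ^ d₂ • Q) *ᵥ ∑ j, c j • v j)) :
    ((Matrix.det (((Polynomial.X : Polynomial ℝ) ^ e) • J.map Polynomial.C
        + ((Polynomial.X : Polynomial ℝ) ^ d₁) • P.map Polynomial.C
        + ((Polynomial.X : Polynomial ℝ) ^ d₂) • Q.map Polynomial.C)).roots.toFinset.filter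
          (fun t => 0 < t)).card ≤ 2 * Fintype.card ι := by
  by_cases hdet : Matrix.det (((Polynomial.X : Polynomial ℝ) ^ e) • J.map Polynomial.C
        + ((Polynomial.X : Polynomial ℝ) ^ d₁) • P.map Polynomial.C
        + ((Polynomial.X : Polynomial ℝ) ^ d₂) • Q.map Polynomial.C) = 0
  · rw [hdet, Polynomial.roots_zero, Multiset.toFinset_zero, Finset.filter_empty, Finset.card_empty]
    exact Nat.zero_le _
  · exact vLaw_of_chainLemmas ι e d₁ d₂ J P Q (hA hdet) (hD hdet)

end Summit.ValiantsHypothesis.ValiantsHypothesis.Theorems.LacunarySymmetroidMatrixDescartes
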